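import Mathlib
import Summits.CriticalPhenomena.SAWScalingLimit.Theorems.HexConjecture.Negative.NonVacuity

/-!
# Deep-start endpoint approximations exist (crux `ObservableToSLE`, stmt-CriticalPhenomena-10472;
obstruction W2(a), typed)

Negative/structural lemma (refuter, cdisprove gen 3), built on the HexConjecture disprover's
connectivity engine for the honeycomb mesh of the unit disc
(`Theorems.HexConjecture.Negative.NonVacuity`: `hexDomainGraph_ball_reachable`, `bIn`, `tendsto_bIn`):

* `exists_isEmbEndpointApprox_deep` — on `(𝔻; 1, -1)` there is a legitimate hexagonal endpoint
  approximation whose SOURCE `vOut (⌈δ⁻¹⌉₊ - 3 - ⌈1/√δ⌉₊)` lies at Euclidean depth `≥ √δ` inside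
  the disc, i.e. at LATTICE depth `≥ δ^{-1/2} → ∞` (`infDist (δ·a_δ) 𝔻ᶜ / δ → ∞`), while
  `δ·a_δ → 1` and `a_δ`, `b_δ` are joined in `Ω_δ`.

Consequence for every line on this crux: the conclusion (`HexConjecture`, hence `FullIdentification`
/ `Identification` and each "extension" stub: `DomainExtension`, `stub_extension`,
`stub_domainEndpointUniversality`) quantifies over endpoint approximations started mesoscopically deep
inside the domain — neither a boundary mid-edge (the hypothesis' `a δ ∈ hexDomainBoundary (Λ δ)`) nor
a floor vertex (`IsFloorEndpointApprox`, `BottomRow`) — a regime no instance of `HexObservableLimit`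
(rev 4: root pinned to a horizontal floor with exact half-lattice rows) speaks about; the extension
stubs must bridge it ("mesoscopic height: open", floor-ratio skeleton stub 7).
-/

noncomputable section

open Literature.Probability.RandomPlanarGeometry Literature.Probability.RandomPlanarGeometry.SAW
  Literature.Probability.LatticeModels MeasureTheory Filter Topology Set
open scoped NNReal
open Summit.CriticalPhenomena.SAWScalingLimit.Cruxes.HexConjecture.Negative
open Summit.CriticalPhenomena.SAWScalingLimit.Cruxes.HexConjecture.NonVacuity

namespace Summit.CriticalPhenomena.SAWScalingLimit.Theorems.ObservableToSLE.Negative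

/-- The deep source `vOut (⌈δ⁻¹⌉₊ - 3 - ⌈1/√δ⌉₊)`: `δ · centre` in coordinates. [folklore] -/
theorem smul_hexCenter_vOut_deep (δ : ℝ) :
    (δ : ℂ) * hexCenter (vOut ((⌈δ⁻¹⌉₊ : ℤ) - 3 - (⌈(Real.sqrt δ)⁻¹⌉₊ : ℤ))) =
      ((δ * (⌈δ⁻¹⌉₊ : ℝ) - δ * (5 / 2) - δ * (⌈(Real.sqrt δ)⁻¹⌉₊ : ℝ) : ℝ) : ℂ) +
        ((δ * (Real.sqrt 3 / 6) : ℝ) : ℂ) * Complex.I := by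
  rw [hexCenter_vOut]; push_cast; ring

/-- Bounds on `δ K(δ)`, `K(δ) = ⌈1/√δ⌉₊` (the mesoscopic offset, `≈ δ^{-1/2}` columns): `√δ ≤ δ K(δ) < √δ + δ`. [folklore] -/
theorem sqrt_le_mul_natCeil_inv_sqrt {δ : ℝ} (hδ : 0 < δ) :
    Real.sqrt δ ≤ δ * (⌈(Real.sqrt δ)⁻¹⌉₊ : ℝ) ∧ δ * (⌈(Real.sqrt δ)⁻¹⌉₊ : ℝ) < Real.sqrt δ + δ := by
  have hs : 0 < Real.sqrt δ := Real.sqrt_pos.2 hδ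
  have hss : Real.sqrt δ * Real.sqrt δ = δ := Real.mul_self_sqrt hδ.le
  have h1 : (Real.sqrt δ)⁻¹ ≤ (⌈(Real.sqrt δ)⁻¹⌉₊ : ℝ) := Nat.le_ceil _
  have h2 : (⌈(Real.sqrt δ)⁻¹⌉₊ : ℝ) < (Real.sqrt δ)⁻¹ + 1 := Nat.ceil_lt_add_one (inv_nonneg.2 hs.le)
  have hinv : δ * (Real.sqrt δ)⁻¹ = Real.sqrt δ := by
    rw [eq_comm, eq_mul_inv_iff_mul_eq₀ hs.ne', hss]
  constructor
  · calc Real.sqrt δ = δ * (Real.sqrt δ)⁻¹ := hinv.symm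
      _ ≤ δ * (⌈(Real.sqrt δ)⁻¹⌉₊ : ℝ) := mul_le_mul_of_nonneg_left h1 hδ.le
  · calc δ * (⌈(Real.sqrt δ)⁻¹⌉₊ : ℝ) < δ * ((Real.sqrt δ)⁻¹ + 1) := mul_lt_mul_of_pos_left h2 hδ
      _ = Real.sqrt δ + δ := by rw [mul_add, hinv, mul_one]

/-- The real part `x(δ)` of the rescaled deep source satisfies `1 - √δ - 7δ/2 < x(δ) < 1 - √δ - 3δ/2`. [folklore] -/
theorem re_deep_bounds {δ : ℝ} (hδ : 0 < δ) :
    1 - Real.sqrt δ - δ * (7 / 2) < δ * (⌈δ⁻¹⌉₊ : ℝ) - δ * (5 / 2) - δ * (⌈(Real.sqrt δ)⁻¹⌉₊ : ℝ) ∧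
    δ * (⌈δ⁻¹⌉₊ : ℝ) - δ * (5 / 2) - δ * (⌈(Real.sqrt δ)⁻¹⌉₊ : ℝ) < 1 - Real.sqrt δ - δ * (3 / 2) := by
  have hc1 : 1 ≤ δ * (⌈δ⁻¹⌉₊ : ℝ) := one_le_mul_natCeil_inv hδ
  have hc2 : δ * (⌈δ⁻¹⌉₊ : ℝ) < 1 + δ := by
    have := Nat.ceil_lt_add_one (inv_nonneg.2 hδ.le)
    calc δ * (⌈δ⁻¹⌉₊ : ℝ) < δ * (δ⁻¹ + 1) := by gcongr
      _ = 1 + δ := by field_simp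
  obtain ⟨hk1, hk2⟩ := sqrt_le_mul_natCeil_inv_sqrt hδ
  constructor <;> linarith

/-- The rescaled deep source tends to the root `1`. [folklore] -/
theorem tendsto_deep_source :
    Tendsto (fun δ : ℝ => (δ : ℂ) * hexCenter (vOut ((⌈δ⁻¹⌉₊ : ℤ) - 3 - (⌈(Real.sqrt δ)⁻¹⌉₊ : ℤ)))) (𝓝[>] (0 : ℝ)) (𝓝 1) := by
  have h0 : Tendsto (fun δ : ℝ => δ) (𝓝[>] (0 : ℝ)) (𝓝 0) := tendsto_nhdsWithin_of_tendsto_nhds tendsto_id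
  have hsq : Tendsto (fun δ : ℝ => Real.sqrt δ) (𝓝[>] (0 : ℝ)) (𝓝 0) := by
    have := (Real.continuous_sqrt.tendsto 0).mono_left (nhdsWithin_le_nhds (s := Set.Ioi (0 : ℝ)))
    simpa using this
  have hre : Tendsto (fun δ : ℝ => δ * (⌈δ⁻¹⌉₊ : ℝ) - δ * (5 / 2) - δ * (⌈(Real.sqrt δ)⁻¹⌉₊ : ℝ))
      (𝓝[>] (0 : ℝ)) (𝓝 1) := by
    have hlo : Tendsto (fun δ : ℝ => 1 - Real.sqrt δ - δ * (7 / 2)) (𝓝[>] (0 : ℝ)) (𝓝 1) := by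
      simpa using ((tendsto_const_nhds (x := (1 : ℝ))).sub hsq).sub (h0.mul_const (7 / 2))
    have hhi : Tendsto (fun δ : ℝ => 1 - Real.sqrt δ - δ * (3 / 2)) (𝓝[>] (0 : ℝ)) (𝓝 1) := by
      simpa using ((tendsto_const_nhds (x := (1 : ℝ))).sub hsq).sub (h0.mul_const (3 / 2))
    refine tendsto_of_tendsto_of_tendsto_of_le_of_le' hlo hhi ?_ ?_
    · filter_upwards [self_mem_nhdsWithin] with δ hδ using (re_deep_bounds hδ).1.le
    · filter_upwards [self_mem_nhdsWithin] with δ hδ using (re_deep_bounds hδ).2.le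
  have him : Tendsto (fun δ : ℝ => δ * (Real.sqrt 3 / 6)) (𝓝[>] (0 : ℝ)) (𝓝 0) := by
    simpa using h0.mul_const (Real.sqrt 3 / 6)
  have h := ((Complex.continuous_ofReal.tendsto 1).comp hre).add
    (((Complex.continuous_ofReal.tendsto 0).comp him).mul
      (tendsto_const_nhds (x := Complex.I)))
  simp only [Function.comp_def, Complex.ofReal_one, Complex.ofReal_zero, zero_mul, add_zero] at h
  exact h.congr' (Eventually.of_forall fun δ => (smul_hexCenter_vOut_deep δ).symm)

/-- For small `δ`, the deep source is a mesh vertex of the disc, with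
`1 - ‖δ · centre‖ ≥ √δ` (Euclidean depth at least `√δ`). [folklore] -/
theorem deep_source_mem_and_depth {δ : ℝ} (hδ : 0 < δ) (hδ1 : δ < 1 / 16) :
    vOut ((⌈δ⁻¹⌉₊ : ℤ) - 3 - (⌈(Real.sqrt δ)⁻¹⌉₊ : ℤ)) ∈ meshBall δ ∧ Real.sqrt δ ≤ 1 - ‖(δ : ℂ) * hexCenter (vOut ((⌈δ⁻¹⌉₊ : ℤ) - 3 - (⌈(Real.sqrt δ)⁻¹⌉₊ : ℤ)))‖ := by
  obtain ⟨hlo, hhi⟩ := re_deep_bounds hδ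
  set x : ℝ := δ * (⌈δ⁻¹⌉₊ : ℝ) - δ * (5 / 2) - δ * (⌈(Real.sqrt δ)⁻¹⌉₊ : ℝ) with hx
  have hs0 : 0 < Real.sqrt δ := Real.sqrt_pos.2 hδ
  have hs1 : Real.sqrt δ < 1 / 4 := by
    rw [show (1 / 4 : ℝ) = Real.sqrt (1 / 16) by
      rw [show (1 / 16 : ℝ) = (1 / 4) ^ 2 by norm_num, Real.sqrt_sq (by norm_num)]]
    exact Real.sqrt_lt_sqrt hδ.le hδ1
  have hx0 : 0 < x := by
    have : δ < 1 / 16 := hδ1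
    linarith
  have h3 : Real.sqrt 3 / 6 < 1 / 2 := by
    have : Real.sqrt 3 < 3 := by
      rw [show (3 : ℝ) = Real.sqrt 9 by rw [show (9:ℝ) = 3^2 by norm_num, Real.sqrt_sq (by norm_num)]]
      exact Real.sqrt_lt_sqrt (by norm_num) (by norm_num)
    linarith
  have hnorm : ‖(δ : ℂ) * hexCenter (vOut ((⌈δ⁻¹⌉₊ : ℤ) - 3 - (⌈(Real.sqrt δ)⁻¹⌉₊ : ℤ)))‖ ≤ x + δ * (Real.sqrt 3 / 6) := by
    rw [smul_hexCenter_vOut_deep]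
    calc ‖((x : ℝ) : ℂ) + ((δ * (Real.sqrt 3 / 6) : ℝ) : ℂ) * Complex.I‖
        ≤ ‖((x : ℝ) : ℂ)‖ + ‖((δ * (Real.sqrt 3 / 6) : ℝ) : ℂ) * Complex.I‖ := norm_add_le _ _
      _ = x + δ * (Real.sqrt 3 / 6) := by
          rw [norm_mul, Complex.norm_I, mul_one, Complex.norm_real, Complex.norm_real,
            Real.norm_of_nonneg hx0.le, Real.norm_of_nonneg (by positivity)]
  have hdepth : Real.sqrt δ ≤ 1 - ‖(δ : ℂ) * hexCenter (vOut ((⌈δ⁻¹⌉₊ : ℤ) - 3 - (⌈(Real.sqrt δ)⁻¹⌉₊ : ℤ)))‖ := by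
    have : x + δ * (Real.sqrt 3 / 6) ≤ 1 - Real.sqrt δ := by nlinarith
    linarith
  refine ⟨?_, hdepth⟩
  rw [mem_meshBall_iff hδ]
  rw [norm_mul, Complex.norm_real, Real.norm_of_nonneg hδ.le] at hdepth
  linarith

/-- Distance to the complement of the unit disc dominates `1 - ‖z‖`. [folklore] -/
theorem one_sub_norm_le_infDist (z : ℂ) :
    1 - ‖z‖ ≤ Metric.infDist z (Metric.ball (0 : ℂ) 1)ᶜ := by
  have hne : ((Metric.ball (0 : ℂ) 1)ᶜ).Nonempty := ⟨2, by simp⟩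
  by_contra h
  obtain ⟨y, hy, hlt⟩ := (Metric.infDist_lt_iff hne).1 (not_le.1 h)
  apply hy
  rw [Metric.mem_ball, dist_zero_right]
  calc ‖y‖ ≤ ‖z‖ + ‖y - z‖ := norm_le_norm_add_norm_sub' y z
    _ = ‖z‖ + dist z y := by rw [dist_comm, dist_eq_norm]
    _ < ‖z‖ + (1 - ‖z‖) := by linarith
    _ = 1 := by ring

/-- **DEEP-START ENDPOINT APPROXIMATIONS EXIST (W2(a) typed).**  On the unit disc `(𝔻; 1, -1)`
there is a hexagonal endpoint approximation `(δ ↦ vOut (⌈δ⁻¹⌉₊ - 3 - ⌈1/√δ⌉₊), bIn)` — so the crux's conclusion and every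
"extension" stub must deliver chordal SLE(8/3) for it — whose SOURCE sits at LATTICE depth
`→ ∞` (Euclidean depth `≥ √δ`, i.e. `≥ δ^{-1/2}` lattice units from `∂𝔻`): a regime about which no
instance of the (floor / boundary-mid-edge) hypothesis `HexObservableLimit` speaks. [folklore] -/
theorem exists_isEmbEndpointApprox_deep :
    ∃ a b : ℝ → HexVertex,
      IsEmbEndpointApprox hexGraph hexCenter DobrushinDomain.unitDisc a b ∧
      Tendsto (fun δ : ℝ => Metric.infDist ((δ : ℂ) * hexCenter (a δ)) (Metric.ball (0 : ℂ) 1)ᶜ / δ)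
        (𝓝[>] (0 : ℝ)) atTop := by
  refine ⟨fun δ => vOut ((⌈δ⁻¹⌉₊ : ℤ) - 3 - (⌈(Real.sqrt δ)⁻¹⌉₊ : ℤ)), bIn, ⟨?_, ?_, ?_⟩, ?_⟩
  · filter_upwards [Ioo_mem_nhdsGT (show (0 : ℝ) < 1 / 16 by norm_num)] with δ hδ
    exact hexDomainGraph_ball_reachable hδ.1 (by linarith [hδ.2]) (deep_source_mem_and_depth hδ.1 hδ.2).1
      (bIn_mem hδ.1 (by linarith [hδ.2]))
  · rw [Literature.Probability.Percolation.unitDisc_pt_zero]; exact tendsto_deep_source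
  · rw [unitDisc_pt_one]; exact tendsto_bIn
  · -- depth / δ ≥ √δ / δ = 1/√δ → ∞
    have hlow : Tendsto (fun δ : ℝ => Real.sqrt δ / δ) (𝓝[>] (0 : ℝ)) atTop := by
      have h1 : Tendsto (fun δ : ℝ => (Real.sqrt δ)⁻¹) (𝓝[>] (0 : ℝ)) atTop := by
        have hsq : Tendsto (fun δ : ℝ => Real.sqrt δ) (𝓝[>] (0 : ℝ)) (𝓝[>] 0) := by
          refine tendsto_nhdsWithin_iff.2 ⟨?_, ?_⟩
          · have := (Real.continuous_sqrt.tendsto 0).mono_left (nhdsWithin_le_nhds (s := Set.Ioi (0 : ℝ)))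
            simpa using this
          · filter_upwards [self_mem_nhdsWithin] with δ hδ using Real.sqrt_pos.2 hδ
        exact tendsto_inv_nhdsGT_zero.comp hsq
      refine h1.congr' ?_
      filter_upwards [self_mem_nhdsWithin] with δ (hδ : 0 < δ)
      have hs : Real.sqrt δ ≠ 0 := (Real.sqrt_pos.2 hδ).ne'
      have hss : Real.sqrt δ * Real.sqrt δ = δ := Real.mul_self_sqrt hδ.le
      rw [inv_eq_one_div, div_eq_div_iff hs hδ.ne', one_mul, hss]
    refine tendsto_atTop_mono' _ ?_ hlow
    filter_upwards [Ioo_mem_nhdsGT (show (0 : ℝ) < 1 / 16 by norm_num)] with δ hδ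
    exact div_le_div_of_nonneg_right
      ((deep_source_mem_and_depth hδ.1 hδ.2).2.trans (one_sub_norm_le_infDist _)) hδ.1.le

end Summit.CriticalPhenomena.SAWScalingLimit.Theorems.ObservableToSLE.Negative
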